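import Literature.NumberTheory.EllipticCurves.IsogenyQuotientCurveProofs
import Literature.NumberTheory.EllipticCurves.VeluDiscriminantProofs
import HarnessLib

/-!
# The quotient curve `E/S` of the tree is Vélu's curve: `Δ(E/S)·Π_{v ∈ S∖O}(2y(v))⁴ = Δ(E)^{#S}`
# for the quotient isogeny of Silverman III.4.12 (proofs only)

Topic `NumberTheory/EllipticCurves`; THEOREMS ONLY. Bridge between the tree's quotient
`WeierstrassCurve.quotCurve S hS hstab` (`IsogenyQuotientCurveProofs`: the elliptic curve `E/S`
over `K` with the `K`-isogeny `quotIsogeny` of kernel `S` and degree `#S`, built on the traces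
`x_S = Σ_s τ_s^* x`, `y_S = Σ_s τ_s^* y`) and Vélu's explicit model (`VeluOddKernelProofs`,
`VeluDiscriminantProofs`), for a short Weierstrass elliptic curve `E : y² = x³ + a₄x + a₆` over a
field `K` of characteristic `0` and a finite `Γ_K`-stable subgroup `S ⊆ E(K̄)` WITHOUT points of
order `2` (Vélu's kernel is `S` as a finset of points of `(E⁄K̄)⁄K̄`, the spelling of the Vélu
files; `t₀ = Σ_{v ∈ S∖O} x(v)` — written `Σ_{v ∈ S} x(v)` with the junk value `x(O) = 0` —, `a' = veluA`,
`b' = veluB`):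

* `isRelation_of_values` — a Weierstrass relation among `x_S, y_S` holds as soon as it holds on
  the values `Σ_s x(Q+s), Σ_s y(Q+s)` at every `Q ∉ S` (a function vanishing off `S` is zero);
* `isRelation_velu` — the relation IS Vélu's: `y_S² = (x_S - t₀)³ + a'(x_S - t₀) + b'`
  (`veluMap_mem` on values);
* `relCoeff_eq_velu` — by uniqueness the tree's coefficients are `(1, 0, -3t₀, 0, 3t₀² + a',
  -t₀³ - a't₀ + b')`: `E/S` is the translate `x ↦ x + t₀` of Vélu's `y² = x³ + a'x + b'`;
* `algebraMap_Δ_quotCurve` — `Δ(E/S) = -16(4a'³ + 27b'²)` in `K̄`;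
* **`algebraMap_Δ_quotCurve_mul_prod_pow_four`** — `Δ(E/S)·Π_{v ∈ S∖O}(2y(v))⁴ = Δ(E)^{#S}`,
  the discriminant relation of Dokchitser–Dokchitser 2015, Thm. 3 / Table 1 for the tree's
  quotient isogeny with odd kernel (`VeluDiscriminantCoatesProofs` supplies the `12`-th power for
  cyclic kernels of order prime to `6`; the degree-one uniqueness of quotients transfers it to any
  `K`-isogeny with kernel `S`).

## References
* [SilvermanAEC2009] J. H. Silverman, *AEC*, Prop. III.4.12, Rem. III.4.13.2 (the quotient).
* [Velu1971] J. Vélu, C. R. Acad. Sci. Paris 273 (1971) 238–241 (the explicit equations).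
* [DokchitserDokchitser2015LocalInvariants] T. Dokchitser, V. Dokchitser, Trans. AMS 367 (2015),
  §2 Thm. 3, Table 1.
-/

noncomputable section

open scoped Classical

open Finset

universe u

namespace WeierstrassCurve

open geomPoints Affine Affine.Point Literature.NumberTheory.EllipticCurves.WeierstrassFunctionField

variable {K : Type u} [Field K] {W : WeierstrassCurve K}

/-- The coordinate `xy R 0` of a geometric point is `xOf R` (junk value `0` at `O` on both
sides). Private plumbing. [folklore] -/
private theorem xy_zero_eq_xOf (R : W.geomPoints) :
    xy R 0 = xOf (R : (W⁄(AlgebraicClosure K)).toAffine.Point) := by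
  rcases R with _ | ⟨x, y, h⟩ <;> rfl

/-- The coordinate `xy R 1` of a geometric point is `yOf R`. Private plumbing. [folklore] -/
private theorem xy_one_eq_yOf (R : W.geomPoints) :
    xy R 1 = yOf (R : (W⁄(AlgebraicClosure K)).toAffine.Point) := by
  rcases R with _ | ⟨x, y, h⟩ <;> rfl

variable [W.IsElliptic]
variable {S : AddSubgroup W.geomPoints} (hS : (S : Set W.geomPoints).Finite)

/-- **A Weierstrass relation among the traces holds as soon as it holds on values off `S`**: if
`b² = Σ cᵢ monoValᵢ(a, b)` for `a = Σ_s x(Q+s)`, `b = Σ_s y(Q+s)` at every `Q ∉ S`, then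
`y_S² = Σ cᵢ monoᵢ` in `K̄(E)` (the difference vanishes at the infinitely many `Q ∉ S`, hence is
zero, Silverman *AEC* II.1.2). [cite: SilvermanAEC2009, Prop. II.1.2 (a nonzero function has finitely many zeros)] -/
theorem isRelation_of_values (c : Fin 6 → AlgebraicClosure K)
    (h : ∀ Q : W.geomPoints, Q ∉ S →
      (∑ s ∈ hS.toFinset, xy (Q + s) 1) ^ 2 =
        ∑ i, c i * quotMonoVal (∑ s ∈ hS.toFinset, xy (Q + s) 0) (∑ s ∈ hS.toFinset, xy (Q + s) 1) i) :
    W.IsRelation S hS c := by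
  rw [IsRelation, ← sub_eq_zero]
  apply eq_zero_of_infinite_setOf_hasValueAt_zero
  have hsub : (S : Set W.geomPoints)ᶜ ⊆
      {Q : W.geomPoints | Q ≠ 0 ∧ W.HasValueAt (W.trY S hS ^ 2 - ∑ i, c i • W.quotMono S hS i) Q 0} := by
    intro Q hQ
    rw [Set.mem_compl_iff, SetLike.mem_coe] at hQ
    have hQ0 : Q ≠ 0 := fun h0 ↦ hQ (h0 ▸ S.zero_mem)
    have ha := hasValueAt_trX hS hQ
    have hb := hasValueAt_trY hS hQ
    have hval : W.HasValueAt (W.trY S hS ^ 2 - ∑ i, c i • W.quotMono S hS i) Q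
        ((∑ s ∈ hS.toFinset, xy (Q + s) 1) ^ 2 -
          ∑ i, c i * quotMonoVal (∑ s ∈ hS.toFinset, xy (Q + s) 0)
            (∑ s ∈ hS.toFinset, xy (Q + s) 1) i) := by
      refine (hb.pow 2).sub (HasValueAt.sum _ fun i _ ↦ ?_)
      rw [Algebra.smul_def]
      exact (hasValueAt_algebraMap _ Q).mul (hasValueAt_quotMono hS ha hb i)
    rw [h Q hQ, sub_self] at hval
    exact ⟨hQ0, hval⟩
  exact (Set.Finite.infinite_compl hS).mono hsub

variable [CharZero K] [W.IsShortNF]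

omit [W.IsElliptic] [CharZero K] [W.IsShortNF] in
/-- A finite subgroup `S ⊆ E(K̄)` without points of order `2` is an odd subgroup finset of
`E(K̄)` in the sense of `VeluOddKernelProofs`. Private plumbing. [folklore] -/
private theorem isOddSubgroupFinset_toFinset (hodd : ∀ s ∈ S, -s = s → s = 0) :
    IsOddSubgroupFinset
      hS.toFinset := by
  refine ⟨?_, ?_, ?_, ?_⟩
  · exact hS.mem_toFinset.mpr S.zero_mem
  · intro u hu v hv
    exact hS.mem_toFinset.mpr (S.add_mem (hS.mem_toFinset.mp hu) (hS.mem_toFinset.mp hv))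
  · intro v hv
    exact hS.mem_toFinset.mpr (S.neg_mem (hS.mem_toFinset.mp hv))
  · intro v hv h
    exact hodd v (hS.mem_toFinset.mp hv) h

/-- **Vélu's relation on values**: for `Q ∉ S`, with `a = Σ_s x(Q+s)`, `b = Σ_s y(Q+s)`,
`t₀ = Σ_{v ∈ S∖O} x(v)` and Vélu's `a', b'`: `b² = (a - t₀)³ + a'(a - t₀) + b'`.
[cite: Velu1971, (the point `(X, Y) = (x + Σ…, y + Σ…)` lies on `y² = x³ + A₄'x + A₆'`)] -/
theorem velu_relation_values (hodd : ∀ s ∈ S, -s = s → s = 0) (Q : W.geomPoints) (hQ : Q ∉ S) :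
    (∑ s ∈ hS.toFinset, xy (Q + s) 1) ^ 2 =
      (∑ s ∈ hS.toFinset, xy (Q + s) 0 -
          ∑ v ∈ hS.toFinset, xOf v) ^ 3 +
        veluA hS.toFinset *
          (∑ s ∈ hS.toFinset, xy (Q + s) 0 -
            ∑ v ∈ hS.toFinset, xOf v) +
        veluB hS.toFinset := by
  set L := AlgebraicClosure K
  set G : Finset W.geomPoints := hS.toFinset with hGdef
  have hG : IsOddSubgroupFinset G := isOddSubgroupFinset_toFinset hS hodd
  have hQ0 : Q ≠ 0 := fun h0 ↦ hQ (h0 ▸ S.zero_mem)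
  obtain ⟨x₀, y₀, h₀, hQeq⟩ : ∃ (x₀ y₀ : L) (h₀ : (W⁄L).toAffine.Nonsingular x₀ y₀),
      Q = Point.some x₀ y₀ h₀ := by
    rcases Q with _ | ⟨x₀, y₀, h₀⟩
    · exact (hQ0 rfl).elim
    · exact ⟨x₀, y₀, h₀, rfl⟩
  have hgood : ∀ v : W.geomPoints, v ≠ 0 → v ∈ G → xOf v ≠ x₀ := by
    intro v hv0 hv hx
    have hvS : v ∈ S := hS.mem_toFinset.mp hv
    have hxQ : xOf v = xOf Q := by rw [hQeq, xOf_some]; exact hx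
    rcases eq_or_eq_neg_of_xOf_eq hv0 hQ0 hxQ with h1 | h1
    · exact hQ (h1 ▸ hvS)
    · have e : Q = -v := by rw [h1]; exact (neg_neg Q).symm
      exact hQ (e ▸ S.neg_mem hvS)
  -- Vélu's theorem (stated in `VeluOddKernelProofs` for the curve `(W⁄L)⁄L = W⁄L`)
  obtain ⟨heq, hx, hy⟩ := (W⁄L).veluMap_mem (G := G) hG (x₀ := x₀) (y₀ := y₀) h₀
    (fun v hv => hgood v (Finset.mem_erase.mp hv).1 (Finset.mem_erase.mp hv).2)
  -- the same three facts, read on `W⁄L` and at the point `Q`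
  have heq' : (y₀ * (veluS G).eval x₀ / (veluP₂ G).eval x₀ ^ 2) ^ 2 =
      ((veluU G).eval x₀ / (veluP₂ G).eval x₀) ^ 3 +
        veluA G * ((veluU G).eval x₀ / (veluP₂ G).eval x₀) + veluB G := heq
  have hx' : (veluU G).eval x₀ / (veluP₂ G).eval x₀ =
      ∑ v ∈ G, xOf (Q + v) - ∑ v ∈ G, xOf v := by
    have hx0 := hx
    rw [Finset.sum_erase _ (by exact xOf_zero)] at hx0
    rw [hQeq]
    convert hx0 using 2 <;> rfl
  have hy' : y₀ * (veluS G).eval x₀ / (veluP₂ G).eval x₀ ^ 2 = ∑ v ∈ G, yOf (Q + v) := by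
    rw [hQeq]
    convert hy using 1 <;> rfl
  -- the value sums of the quotient file are Vélu's sums
  have hxa : ∑ v ∈ G, xOf (Q + v) = ∑ s ∈ hS.toFinset, xy (Q + s) 0 :=
    Finset.sum_congr rfl fun s _ => (xy_zero_eq_xOf (Q + s)).symm
  have hyb : ∑ v ∈ G, yOf (Q + v) = ∑ s ∈ hS.toFinset, xy (Q + s) 1 :=
    Finset.sum_congr rfl fun s _ => (xy_one_eq_yOf (Q + s)).symm
  rw [hxa] at hx'
  rw [hyb] at hy'
  rw [hx', hy'] at heq'
  linear_combination heq'

/-- **The Weierstrass relation of the traces is Vélu's**: `W.IsRelation S hS c` with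
`c = (1, 0, -3t₀, 0, 3t₀² + a', -t₀³ - a't₀ + b')`, i.e. `y_S² = (x_S - t₀)³ + a'(x_S - t₀) + b'`
in `K̄(E)`. [cite: Velu1971, (équation de la courbe quotient `y² = x³ + A₄'x + A₆'`)] -/
theorem isRelation_velu (hodd : ∀ s ∈ S, -s = s → s = 0) :
    W.IsRelation S hS
      ![1, 0,
        -3 * ∑ v ∈ hS.toFinset, xOf v,
        0,
        3 * (∑ v ∈ hS.toFinset, xOf v) ^ 2 +
          veluA hS.toFinset,
        -(∑ v ∈ hS.toFinset, xOf v) ^ 3 -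
          veluA hS.toFinset *
            ∑ v ∈ hS.toFinset, xOf v +
          veluB hS.toFinset] := by
  refine isRelation_of_values hS _ fun Q hQ => ?_
  rw [velu_relation_values hS hodd Q hQ, Fin.sum_univ_six]
  simp only [quotMonoVal, Matrix.cons_val_zero, Matrix.cons_val_one, Matrix.cons_val]
  ring

/-- **The coefficients of the quotient relation are Vélu's** (uniqueness of the relation,
`IsRelation.unique`): `c = (1, 0, -3t₀, 0, 3t₀² + a', -t₀³ - a't₀ + b')`. Hence the tree's
`quotCurve S` is `y² = x³ - 3t₀x² + (3t₀² + a')x + (-t₀³ - a't₀ + b')`, the translate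
`x ↦ x + t₀` of Vélu's `y² = x³ + a'x + b'`. [cite: Velu1971, (équation de `E/F`)] -/
theorem relCoeff_eq_velu (hodd : ∀ s ∈ S, -s = s → s = 0) :
    W.relCoeff hS =
      ![1, 0, -3 * ∑ v ∈ hS.toFinset, xOf v, 0,
        3 * (∑ v ∈ hS.toFinset, xOf v) ^ 2 + veluA hS.toFinset,
        -(∑ v ∈ hS.toFinset, xOf v) ^ 3 - veluA hS.toFinset * ∑ v ∈ hS.toFinset, xOf v +
          veluB hS.toFinset] :=
  (isRelation_relCoeff hS).unique hS (isRelation_velu hS hodd)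

variable (hstab : ∀ (σ : Field.absoluteGaloisGroup K) (P : W.geomPoints), P ∈ S → σ • P ∈ S)

/-- **`Δ(E/S)` is the discriminant of Vélu's curve**: in `K̄`,
`Δ(quotCurve S) = Δ(y² = x³ + a'x + b') = -16(4a'³ + 27b'²)` (a translate has the same
discriminant). [cite: Velu1971, (équation de `E/F`)] -/
theorem algebraMap_Δ_quotCurve (hodd : ∀ s ∈ S, -s = s → s = 0) :
    algebraMap K (AlgebraicClosure K) (W.quotCurve S hS hstab).Δ =
      (⟨0, 0, 0, veluA hS.toFinset, veluB hS.toFinset⟩ : WeierstrassCurve (AlgebraicClosure K)).Δ := by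
  have hc := relCoeff_eq_velu hS hodd
  have hK : ∀ i, algebraMap K (AlgebraicClosure K) (W.relCoeffK hS hstab i) = W.relCoeff hS i :=
    algebraMap_relCoeffK hS hstab
  rw [← map_Δ]
  simp only [quotCurve, WeierstrassCurve.map, map_neg, map_mul, map_pow, hK, hc,
    Matrix.cons_val_zero, Matrix.cons_val_one, Matrix.cons_val]
  simp only [Δ, b₂, b₄, b₆, b₈]
  ring

/-- **`Δ(E/S) · Π_{v ∈ S∖O} (2y(v))⁴ = Δ(E)^{#S}`** for the tree's quotient `E/S = quotCurve S`
of a short Weierstrass elliptic curve over a field of characteristic `0` by a finite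
`Γ_K`-stable subgroup `S` without points of order `2` (read in `K̄`): the discriminant relation of
Dokchitser–Dokchitser 2015 (Thm. 3 / Table 1) for the quotient isogeny `quotIsogeny S`
(`ker = S`, `deg = #S`), via `VeluDiscriminantProofs.veluDelta_mul_prod_pow_four` and
`algebraMap_Δ_quotCurve`. [cite: DokchitserDokchitser2015LocalInvariants, §2 Thm. 3 with Table 1 (the discriminants of isogenous curves)] -/
theorem algebraMap_Δ_quotCurve_mul_prod_pow_four (hodd : ∀ s ∈ S, -s = s → s = 0) :
    algebraMap K (AlgebraicClosure K) (W.quotCurve S hS hstab).Δ *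
        ∏ v ∈ @Finset.erase (W⁄(AlgebraicClosure K)).toAffine.Point _ hS.toFinset 0,
          (2 * yOf v) ^ 4 =
      algebraMap K (AlgebraicClosure K) W.Δ ^ hS.toFinset.card := by
  have hG := isOddSubgroupFinset_toFinset hS hodd
  have hV : (⟨0, 0, 0, veluA hS.toFinset, veluB hS.toFinset⟩ :
        WeierstrassCurve (AlgebraicClosure K)).Δ *
      ∏ v ∈ @Finset.erase (W⁄(AlgebraicClosure K)).toAffine.Point _ hS.toFinset 0, (2 * yOf v) ^ 4 =
        (W⁄(AlgebraicClosure K)).Δ ^ hS.toFinset.card :=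
    (W⁄(AlgebraicClosure K)).veluDelta_mul_prod_pow_four hG
  rw [algebraMap_Δ_quotCurve hS hstab hodd, hV]
  exact congrArg (· ^ hS.toFinset.card) (W.map_Δ (algebraMap K (AlgebraicClosure K)))

/-- The same with `#S` as a cardinal of the subgroup (`= deg (quotIsogeny S)`,
`deg_quotIsogeny`). [cite: DokchitserDokchitser2015LocalInvariants, §2 Thm. 3 with Table 1] -/
theorem algebraMap_Δ_quotCurve_mul_prod_pow_four' (hodd : ∀ s ∈ S, -s = s → s = 0) :
    algebraMap K (AlgebraicClosure K) (W.quotCurve S hS hstab).Δ *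
        ∏ v ∈ @Finset.erase (W⁄(AlgebraicClosure K)).toAffine.Point _ hS.toFinset 0,
          (2 * yOf v) ^ 4 =
      algebraMap K (AlgebraicClosure K) W.Δ ^ Nat.card S := by
  rw [algebraMap_Δ_quotCurve_mul_prod_pow_four hS hstab hodd]
  congr 1
  rw [← SetLike.coe_sort_coe, Nat.card_coe_set_eq, Set.ncard_eq_toFinset_card _ hS]

end WeierstrassCurve
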